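import Mathlib
import HarnessLib

/-!
# Planted conditional variances on `{±1}^n`: the tower identity and the one-pin step
# (helpers for item `PinningLemmaCeiling`, stmt-CriticalPhenomena-8454, route `PlantedPinning`)

Finite-sum conditional-expectation calculus behind the pinning-lemma ceiling
(Montanari 2008; Raghavendra–Tan 2012).  Configurations are `Fin n → Bool`, `w` is a probability
weight, and all objects are carried as *variables characterised by hypotheses* (no definitions),
so that the closing file can instantiate them with the `let`-bound terms of the item verbatim:

* `Z P τ = ∑_{σ ~_P τ} w σ` (mass of the fibre of `τ` over `P`; hypothesis `hZ`),
* `cE P f τ = (∑_{σ ~_P τ} w σ f σ) / Z P τ` (conditional expectation `E_w[f | σ_P = τ_P]`; `hcE`),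
* `s z` a `{z}`-measurable function with `s z σ ^ 2 = 1` (the spin at `z`; `hs`, `hs2`),
* `M = ∑_z s z` (total spin; `hM`),
* `V P = ∑_τ w τ (cE P M² τ − (cE P M τ)²)` (planted conditional variance of `M`; `hV`).

Results:
* `tower` — pull-out identity `∑_τ w τ · g τ · cE P f τ = ∑_τ w τ · g τ · f τ` for
  `P`-measurable `g` (swap the double sum over the fibre relation);
* `V_eq_sum_sq`, `V_nonneg`, `V_sub_V` — `V(P) = ∑ w (M − E[M|P])²`,
  `V(P) − V(Q) = ∑ w (E[M|Q] − E[M|P])²` for `P ⊆ Q`;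
* `cross`, `sum_cov`, `e_sq_le` — `V(P) = ∑_{z ∉ P} ∑_τ w (E[M|P∪z] − E[M|P])(s_z − E[s_z|P])`
  and `∑_τ w (s_z − E[s_z|P])² ≤ 1`;
* `one_step` — with `c = |Pᶜ|`, `∑_{z ∉ P} V(P ∪ z) ≤ c V(P) − V(P)²/c`
  (one more uniformly random pin; Cauchy–Schwarz over `(z, τ)`).

Theorem-only file (no definitions).  References: A. Montanari, arXiv:0709.0145, §3;
P. Raghavendra, N. Tan, SODA 2012, doi:10.1137/1.9781611973099.33, Lemma 4.1;
A. El Alaoui, A. Montanari, arXiv:2109.00709, eqs. (1.4)–(1.6).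
-/

noncomputable section

open Finset

namespace Summit.CriticalPhenomena.Ising3DConformalLimit.Theorems.PinningLemma

variable {n : ℕ} {w : (Fin n → Bool) → ℝ}
  {Z : Finset (Fin n) → (Fin n → Bool) → ℝ}
  {cE : Finset (Fin n) → ((Fin n → Bool) → ℝ) → (Fin n → Bool) → ℝ}
  {s : Fin n → (Fin n → Bool) → ℝ} {M : (Fin n → Bool) → ℝ} {V : Finset (Fin n) → ℝ}

/-! ### Fibres -/

/-- Membership in the fibre of `τ` over `P`. -/
theorem mem_fib {P : Finset (Fin n)} {σ τ : Fin n → Bool} :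
    σ ∈ univ.filter (fun ρ => ∀ i ∈ P, ρ i = τ i) ↔ ∀ i ∈ P, σ i = τ i := by
  simp

/-- `τ` lies in its own fibre. -/
theorem self_mem_fib (P : Finset (Fin n)) (τ : Fin n → Bool) :
    τ ∈ univ.filter (fun ρ => ∀ i ∈ P, ρ i = τ i) :=
  mem_fib.2 (fun _ _ => rfl)

/-- Agreeing configurations have the same fibre. -/
theorem fib_eq_of_agree {P : Finset (Fin n)} {σ τ : Fin n → Bool} (h : ∀ i ∈ P, σ i = τ i) :
    (univ : Finset (Fin n → Bool)).filter (fun ρ => ∀ i ∈ P, ρ i = σ i)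
      = univ.filter (fun ρ => ∀ i ∈ P, ρ i = τ i) := by
  ext ρ
  simp only [mem_fib]
  exact ⟨fun hρ i hi => (hρ i hi).trans (h i hi), fun hρ i hi => (hρ i hi).trans (h i hi).symm⟩

/-! ### The fibre mass `Z` and conditional expectations `cE` -/

/-- A weight is dominated by the mass of its fibre. -/
theorem le_Z (hw : ∀ σ, 0 ≤ w σ)
    (hZ : ∀ P τ, Z P τ = ∑ σ ∈ univ.filter (fun ρ => ∀ i ∈ P, ρ i = τ i), w σ)
    (P : Finset (Fin n)) (τ : Fin n → Bool) : w τ ≤ Z P τ := by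
  rw [hZ]
  exact single_le_sum (f := w) (fun σ _ => hw σ) (self_mem_fib P τ)

/-- On a null fibre the weight vanishes. -/
theorem eq_zero_of_Z_eq_zero (hw : ∀ σ, 0 ≤ w σ)
    (hZ : ∀ P τ, Z P τ = ∑ σ ∈ univ.filter (fun ρ => ∀ i ∈ P, ρ i = τ i), w σ)
    {P : Finset (Fin n)} {τ : Fin n → Bool} (h : Z P τ = 0) : w τ = 0 :=
  le_antisymm (h ▸ le_Z hw hZ P τ) (hw τ)

/-- `Z P` is `P`-measurable. -/
theorem Z_eq_of_agree
    (hZ : ∀ P τ, Z P τ = ∑ σ ∈ univ.filter (fun ρ => ∀ i ∈ P, ρ i = τ i), w σ)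
    {P : Finset (Fin n)} {σ τ : Fin n → Bool} (h : ∀ i ∈ P, σ i = τ i) : Z P σ = Z P τ := by
  rw [hZ, hZ, fib_eq_of_agree h]

/-- Conditional expectations `cE P f` are `P`-measurable. -/
theorem cE_eq_of_agree
    (hZ : ∀ P τ, Z P τ = ∑ σ ∈ univ.filter (fun ρ => ∀ i ∈ P, ρ i = τ i), w σ)
    (hcE : ∀ P f τ, cE P f τ
      = (∑ σ ∈ univ.filter (fun ρ => ∀ i ∈ P, ρ i = τ i), w σ * f σ) / Z P τ)
    (P : Finset (Fin n)) (f : (Fin n → Bool) → ℝ) :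
    ∀ σ τ : Fin n → Bool, (∀ i ∈ P, σ i = τ i) → cE P f σ = cE P f τ := fun σ τ h => by
  rw [hcE, hcE, Z_eq_of_agree hZ h, fib_eq_of_agree h]

/-- **Tower / pull-out identity.** For `P`-measurable `g`,
`∑_τ w τ · g τ · E[f | σ_P = τ_P] = ∑_τ w τ · g τ · f τ`. -/
theorem tower (hw : ∀ σ, 0 ≤ w σ)
    (hZ : ∀ P τ, Z P τ = ∑ σ ∈ univ.filter (fun ρ => ∀ i ∈ P, ρ i = τ i), w σ)
    (hcE : ∀ P f τ, cE P f τ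
      = (∑ σ ∈ univ.filter (fun ρ => ∀ i ∈ P, ρ i = τ i), w σ * f σ) / Z P τ)
    {P : Finset (Fin n)} {g : (Fin n → Bool) → ℝ}
    (hg : ∀ σ τ : Fin n → Bool, (∀ i ∈ P, σ i = τ i) → g σ = g τ) (f : (Fin n → Bool) → ℝ) :
    ∑ τ, w τ * (g τ * cE P f τ) = ∑ τ, w τ * (g τ * f τ) := by
  have key : ∀ σ τ : Fin n → Bool, (∀ i ∈ P, σ i = τ i) →
      w τ * (g τ * (w σ * f σ / Z P τ)) = w τ * (g σ * (w σ * f σ) / Z P σ) := by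
    intro σ τ h
    rw [hg σ τ h, Z_eq_of_agree hZ h]; ring
  calc ∑ τ, w τ * (g τ * cE P f τ)
      = ∑ τ, ∑ σ ∈ univ.filter (fun ρ => ∀ i ∈ P, ρ i = τ i),
          w τ * (g τ * (w σ * f σ / Z P τ)) := by
        refine sum_congr rfl (fun τ _ => ?_)
        rw [hcE, sum_div, mul_sum, mul_sum]
    _ = ∑ τ, ∑ σ, if (∀ i ∈ P, σ i = τ i) then w τ * (g τ * (w σ * f σ / Z P τ)) else 0 := by
        refine sum_congr rfl (fun τ _ => ?_)
        rw [sum_filter]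
    _ = ∑ σ, ∑ τ, if (∀ i ∈ P, σ i = τ i) then w τ * (g τ * (w σ * f σ / Z P τ)) else 0 :=
        sum_comm
    _ = ∑ σ, ∑ τ, if (∀ i ∈ P, τ i = σ i) then w τ * (g σ * (w σ * f σ) / Z P σ) else 0 := by
        refine sum_congr rfl (fun σ _ => sum_congr rfl (fun τ _ => ?_))
        by_cases h : ∀ i ∈ P, σ i = τ i
        · have h' : ∀ i ∈ P, τ i = σ i := fun i hi => (h i hi).symm
          rw [if_pos h, if_pos h', key σ τ h]
        · have h' : ¬ ∀ i ∈ P, τ i = σ i := fun h' => h (fun i hi => (h' i hi).symm)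
          rw [if_neg h, if_neg h']
    _ = ∑ σ, Z P σ * (g σ * (w σ * f σ) / Z P σ) := by
        refine sum_congr rfl (fun σ _ => ?_)
        generalize g σ * (w σ * f σ) / Z P σ = X
        rw [hZ, sum_mul, sum_filter]
    _ = ∑ τ, w τ * (g τ * f τ) := by
        refine sum_congr rfl (fun σ _ => ?_)
        by_cases h0 : Z P σ = 0
        · rw [h0, eq_zero_of_Z_eq_zero hw hZ h0]; simp
        · field_simp

/-- Tower identity with `g = 1`: `∑_τ w τ · E[f | σ_P = τ_P] = ∑_τ w τ · f τ`. -/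
theorem tower_one (hw : ∀ σ, 0 ≤ w σ)
    (hZ : ∀ P τ, Z P τ = ∑ σ ∈ univ.filter (fun ρ => ∀ i ∈ P, ρ i = τ i), w σ)
    (hcE : ∀ P f τ, cE P f τ
      = (∑ σ ∈ univ.filter (fun ρ => ∀ i ∈ P, ρ i = τ i), w σ * f σ) / Z P τ)
    (P : Finset (Fin n)) (f : (Fin n → Bool) → ℝ) :
    ∑ τ, w τ * cE P f τ = ∑ τ, w τ * f τ := by
  have h := tower hw hZ hcE (P := P) (g := fun _ => (1 : ℝ)) (fun _ _ _ => rfl) f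
  simpa only [one_mul] using h

/-- `∑_τ w τ · E[f|P]² = ∑_τ w τ · E[f|P] · f`. -/
theorem sum_cE_sq (hw : ∀ σ, 0 ≤ w σ)
    (hZ : ∀ P τ, Z P τ = ∑ σ ∈ univ.filter (fun ρ => ∀ i ∈ P, ρ i = τ i), w σ)
    (hcE : ∀ P f τ, cE P f τ
      = (∑ σ ∈ univ.filter (fun ρ => ∀ i ∈ P, ρ i = τ i), w σ * f σ) / Z P τ)
    (P : Finset (Fin n)) (f : (Fin n → Bool) → ℝ) :
    ∑ τ, w τ * cE P f τ ^ 2 = ∑ τ, w τ * (cE P f τ * f τ) := by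
  rw [← tower hw hZ hcE (cE_eq_of_agree hZ hcE P f) f]
  simp only [sq]

/-! ### The planted conditional variance `V` -/

/-- `V(P) = ∑ w M² − ∑ w E[M|P]²`. -/
theorem V_eq (hw : ∀ σ, 0 ≤ w σ)
    (hZ : ∀ P τ, Z P τ = ∑ σ ∈ univ.filter (fun ρ => ∀ i ∈ P, ρ i = τ i), w σ)
    (hcE : ∀ P f τ, cE P f τ
      = (∑ σ ∈ univ.filter (fun ρ => ∀ i ∈ P, ρ i = τ i), w σ * f σ) / Z P τ)
    (hV : ∀ P, V P = ∑ τ, w τ * (cE P (fun σ => M σ ^ 2) τ - cE P M τ ^ 2))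
    (P : Finset (Fin n)) :
    V P = ∑ τ, w τ * M τ ^ 2 - ∑ τ, w τ * cE P M τ ^ 2 := by
  simp only [hV, mul_sub, sum_sub_distrib, tower_one hw hZ hcE]

/-- `V(P) = ∑ w (M − E[M|P])²`. -/
theorem V_eq_sum_sq (hw : ∀ σ, 0 ≤ w σ)
    (hZ : ∀ P τ, Z P τ = ∑ σ ∈ univ.filter (fun ρ => ∀ i ∈ P, ρ i = τ i), w σ)
    (hcE : ∀ P f τ, cE P f τ
      = (∑ σ ∈ univ.filter (fun ρ => ∀ i ∈ P, ρ i = τ i), w σ * f σ) / Z P τ)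
    (hV : ∀ P, V P = ∑ τ, w τ * (cE P (fun σ => M σ ^ 2) τ - cE P M τ ^ 2))
    (P : Finset (Fin n)) :
    V P = ∑ τ, w τ * (M τ - cE P M τ) ^ 2 := by
  rw [V_eq hw hZ hcE hV]
  have h := sum_cE_sq hw hZ hcE P M
  have e : ∀ τ, w τ * (M τ - cE P M τ) ^ 2 =
      w τ * M τ ^ 2 - 2 * (w τ * (cE P M τ * M τ)) + w τ * cE P M τ ^ 2 := by
    intro τ; ring
  simp only [e, sum_add_distrib, sum_sub_distrib, ← mul_sum, ← h]
  ring

/-- Planted conditional variances are nonnegative. -/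
theorem V_nonneg (hw : ∀ σ, 0 ≤ w σ)
    (hZ : ∀ P τ, Z P τ = ∑ σ ∈ univ.filter (fun ρ => ∀ i ∈ P, ρ i = τ i), w σ)
    (hcE : ∀ P f τ, cE P f τ
      = (∑ σ ∈ univ.filter (fun ρ => ∀ i ∈ P, ρ i = τ i), w σ * f σ) / Z P τ)
    (hV : ∀ P, V P = ∑ τ, w τ * (cE P (fun σ => M σ ^ 2) τ - cE P M τ ^ 2))
    (P : Finset (Fin n)) : 0 ≤ V P := by
  rw [V_eq_sum_sq hw hZ hcE hV]
  exact sum_nonneg (fun τ _ => mul_nonneg (hw τ) (sq_nonneg _))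

/-- Variance reduction by further pinning: `V(P) − V(Q) = ∑ w (E[M|Q] − E[M|P])²` for `P ⊆ Q`. -/
theorem V_sub_V (hw : ∀ σ, 0 ≤ w σ)
    (hZ : ∀ P τ, Z P τ = ∑ σ ∈ univ.filter (fun ρ => ∀ i ∈ P, ρ i = τ i), w σ)
    (hcE : ∀ P f τ, cE P f τ
      = (∑ σ ∈ univ.filter (fun ρ => ∀ i ∈ P, ρ i = τ i), w σ * f σ) / Z P τ)
    (hV : ∀ P, V P = ∑ τ, w τ * (cE P (fun σ => M σ ^ 2) τ - cE P M τ ^ 2))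
    {P Q : Finset (Fin n)} (hPQ : P ⊆ Q) :
    V P - V Q = ∑ τ, w τ * (cE Q M τ - cE P M τ) ^ 2 := by
  rw [V_eq hw hZ hcE hV, V_eq hw hZ hcE hV]
  have hmeas : ∀ σ τ : Fin n → Bool, (∀ i ∈ Q, σ i = τ i) → cE P M σ = cE P M τ :=
    fun σ τ h => cE_eq_of_agree hZ hcE P M σ τ (fun i hi => h i (hPQ hi))
  have h1 : ∑ τ, w τ * (cE P M τ * cE Q M τ) = ∑ τ, w τ * cE P M τ ^ 2 := by
    rw [tower hw hZ hcE hmeas M, sum_cE_sq hw hZ hcE]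
  have e : ∀ τ, w τ * (cE Q M τ - cE P M τ) ^ 2 =
      w τ * cE Q M τ ^ 2 - 2 * (w τ * (cE P M τ * cE Q M τ)) + w τ * cE P M τ ^ 2 := by
    intro τ; ring
  simp only [e, sum_add_distrib, sum_sub_distrib, ← mul_sum, h1]
  ring

/-! ### One more pin: covariances with the unpinned spins -/

/-- The cross term: `∑ w (E[M|P∪z] − E[M|P])(s_z − E[s_z|P]) = ∑ w s_z M − ∑ w E[M|P] s_z`. -/
theorem cross (hw : ∀ σ, 0 ≤ w σ)
    (hZ : ∀ P τ, Z P τ = ∑ σ ∈ univ.filter (fun ρ => ∀ i ∈ P, ρ i = τ i), w σ)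
    (hcE : ∀ P f τ, cE P f τ
      = (∑ σ ∈ univ.filter (fun ρ => ∀ i ∈ P, ρ i = τ i), w σ * f σ) / Z P τ)
    (hs : ∀ (z : Fin n) (σ τ : Fin n → Bool), σ z = τ z → s z σ = s z τ)
    (P : Finset (Fin n)) (z : Fin n) :
    ∑ τ, w τ * ((cE (insert z P) M τ - cE P M τ) * (s z τ - cE P (s z) τ))
      = ∑ τ, w τ * (s z τ * M τ) - ∑ τ, w τ * (cE P M τ * s z τ) := by
  have hPQ : P ⊆ insert z P := subset_insert z P
  have ms : ∀ σ τ : Fin n → Bool, (∀ i ∈ insert z P, σ i = τ i) → s z σ = s z τ :=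
    fun σ τ h => hs z σ τ (h z (mem_insert_self z P))
  have mQ : ∀ σ τ : Fin n → Bool, (∀ i ∈ insert z P, σ i = τ i) → cE P (s z) σ = cE P (s z) τ :=
    fun σ τ h => cE_eq_of_agree hZ hcE P (s z) σ τ (fun i hi => h i (hPQ hi))
  have t1 : ∑ τ, w τ * (s z τ * cE (insert z P) M τ) = ∑ τ, w τ * (s z τ * M τ) :=
    tower hw hZ hcE ms M
  have t2 : ∑ τ, w τ * (cE P (s z) τ * cE (insert z P) M τ)
      = ∑ τ, w τ * (cE P (s z) τ * M τ) :=
    tower hw hZ hcE mQ M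
  have t2' : ∑ τ, w τ * (cE P (s z) τ * cE P M τ) = ∑ τ, w τ * (cE P (s z) τ * M τ) :=
    tower hw hZ hcE (cE_eq_of_agree hZ hcE P (s z)) M
  have t3 : ∑ τ, w τ * (cE P M τ * cE P (s z) τ) = ∑ τ, w τ * (cE P M τ * s z τ) :=
    tower hw hZ hcE (cE_eq_of_agree hZ hcE P M) (s z)
  have comm : ∑ τ, w τ * (cE P (s z) τ * cE P M τ) = ∑ τ, w τ * (cE P M τ * cE P (s z) τ) :=
    sum_congr rfl (fun τ _ => by ring)
  have e : ∀ τ, w τ * ((cE (insert z P) M τ - cE P M τ) * (s z τ - cE P (s z) τ))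
      = w τ * (s z τ * cE (insert z P) M τ) - w τ * (cE P (s z) τ * cE (insert z P) M τ)
        - w τ * (cE P M τ * s z τ) + w τ * (cE P M τ * cE P (s z) τ) := by
    intro τ; ring
  simp only [e, sum_add_distrib, sum_sub_distrib]
  rw [t1, t2, ← t2', comm, t3]
  ring

/-- `∑_τ w τ (s_z − E[s_z|P])² ≤ 1`. -/
theorem e_sq_le (hw : ∀ σ, 0 ≤ w σ) (hsum : ∑ σ, w σ = 1)
    (hZ : ∀ P τ, Z P τ = ∑ σ ∈ univ.filter (fun ρ => ∀ i ∈ P, ρ i = τ i), w σ)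
    (hcE : ∀ P f τ, cE P f τ
      = (∑ σ ∈ univ.filter (fun ρ => ∀ i ∈ P, ρ i = τ i), w σ * f σ) / Z P τ)
    (hs2 : ∀ (z : Fin n) (σ : Fin n → Bool), s z σ ^ 2 = 1)
    (P : Finset (Fin n)) (z : Fin n) :
    ∑ τ, w τ * (s z τ - cE P (s z) τ) ^ 2 ≤ 1 := by
  have t := tower hw hZ hcE (cE_eq_of_agree hZ hcE P (s z)) (s z)
  have e : ∀ τ, w τ * (s z τ - cE P (s z) τ) ^ 2 =
      w τ * s z τ ^ 2 - 2 * (w τ * (cE P (s z) τ * s z τ))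
        + w τ * (cE P (s z) τ * cE P (s z) τ) := by
    intro τ; ring
  have h1 : ∑ τ, w τ * s z τ ^ 2 = 1 := by
    simp only [hs2, mul_one]; exact hsum
  have h2 : 0 ≤ ∑ τ, w τ * (cE P (s z) τ * cE P (s z) τ) :=
    sum_nonneg (fun τ _ => mul_nonneg (hw τ) (mul_self_nonneg _))
  simp only [e, sum_add_distrib, sum_sub_distrib, ← mul_sum, ← t]
  linarith

/-- The planted covariances of `M` with the unpinned spins add up to `V(P)`:
`∑_{z ∉ P} (∑ w s_z M − ∑ w E[M|P] s_z) = V(P)`. -/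
theorem sum_cov (hw : ∀ σ, 0 ≤ w σ)
    (hZ : ∀ P τ, Z P τ = ∑ σ ∈ univ.filter (fun ρ => ∀ i ∈ P, ρ i = τ i), w σ)
    (hcE : ∀ P f τ, cE P f τ
      = (∑ σ ∈ univ.filter (fun ρ => ∀ i ∈ P, ρ i = τ i), w σ * f σ) / Z P τ)
    (hs : ∀ (z : Fin n) (σ τ : Fin n → Bool), σ z = τ z → s z σ = s z τ)
    (hM : ∀ σ, M σ = ∑ z, s z σ)
    (hV : ∀ P, V P = ∑ τ, w τ * (cE P (fun σ => M σ ^ 2) τ - cE P M τ ^ 2))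
    (P : Finset (Fin n)) :
    ∑ z ∈ Pᶜ, (∑ τ, w τ * (s z τ * M τ) - ∑ τ, w τ * (cE P M τ * s z τ)) = V P := by
  have hsplit : ∀ τ : Fin n → Bool, ∑ z ∈ Pᶜ, s z τ = M τ - ∑ z ∈ P, s z τ := by
    intro τ
    rw [hM, ← sum_add_sum_compl P (fun z => s z τ)]
    ring
  have hA : ∑ z ∈ Pᶜ, ∑ τ, w τ * (s z τ * M τ)
      = ∑ τ, w τ * M τ ^ 2 - ∑ τ, w τ * ((∑ z ∈ P, s z τ) * M τ) := by
    rw [sum_comm, ← sum_sub_distrib]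
    refine sum_congr rfl (fun τ _ => ?_)
    rw [← mul_sum, ← sum_mul, hsplit τ]
    ring
  have hB : ∑ z ∈ Pᶜ, ∑ τ, w τ * (cE P M τ * s z τ)
      = ∑ τ, w τ * (cE P M τ * M τ) - ∑ τ, w τ * (cE P M τ * ∑ z ∈ P, s z τ) := by
    rw [sum_comm, ← sum_sub_distrib]
    refine sum_congr rfl (fun τ _ => ?_)
    rw [← mul_sum, ← mul_sum, hsplit τ]
    ring
  have mP : ∀ σ τ : Fin n → Bool, (∀ i ∈ P, σ i = τ i) →
      ∑ z ∈ P, s z σ = ∑ z ∈ P, s z τ :=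
    fun σ τ h => sum_congr rfl (fun z hz => hs z σ τ (h z hz))
  have t1 : ∑ τ, w τ * ((∑ z ∈ P, s z τ) * cE P M τ) = ∑ τ, w τ * ((∑ z ∈ P, s z τ) * M τ) :=
    tower hw hZ hcE mP M
  have comm : ∑ τ, w τ * (cE P M τ * ∑ z ∈ P, s z τ)
      = ∑ τ, w τ * ((∑ z ∈ P, s z τ) * cE P M τ) :=
    sum_congr rfl (fun τ _ => by ring)
  rw [sum_sub_distrib, hA, hB, comm, t1, ← sum_cE_sq hw hZ hcE, V_eq hw hZ hcE hV]
  ring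

/-- Weighted Cauchy–Schwarz for a double sum. -/
theorem weighted_cs {α β : Type*} (S : Finset α) (T : Finset β) (u : β → ℝ) (a b : α → β → ℝ)
    (hu : ∀ j ∈ T, 0 ≤ u j) :
    (∑ i ∈ S, ∑ j ∈ T, u j * (a i j * b i j)) ^ 2
      ≤ (∑ i ∈ S, ∑ j ∈ T, u j * a i j ^ 2) * (∑ i ∈ S, ∑ j ∈ T, u j * b i j ^ 2) := by
  have h := sum_sq_le_sum_mul_sum_of_sq_le_mul (S ×ˢ T)
    (r := fun p => u p.2 * (a p.1 p.2 * b p.1 p.2))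
    (f := fun p => u p.2 * a p.1 p.2 ^ 2) (g := fun p => u p.2 * b p.1 p.2 ^ 2)
    (fun p hp => mul_nonneg (hu p.2 (mem_product.1 hp).2) (sq_nonneg _))
    (fun p hp => mul_nonneg (hu p.2 (mem_product.1 hp).2) (sq_nonneg _))
    (fun p _ => le_of_eq (by ring))
  simpa only [sum_product] using h

/-- **One more uniformly random pin.** With `c = |Pᶜ| > 0`,
`∑_{z ∉ P} V(P ∪ z) ≤ c · V(P) − V(P)²/c`. -/
theorem one_step (hw : ∀ σ, 0 ≤ w σ) (hsum : ∑ σ, w σ = 1)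
    (hZ : ∀ P τ, Z P τ = ∑ σ ∈ univ.filter (fun ρ => ∀ i ∈ P, ρ i = τ i), w σ)
    (hcE : ∀ P f τ, cE P f τ
      = (∑ σ ∈ univ.filter (fun ρ => ∀ i ∈ P, ρ i = τ i), w σ * f σ) / Z P τ)
    (hs : ∀ (z : Fin n) (σ τ : Fin n → Bool), σ z = τ z → s z σ = s z τ)
    (hs2 : ∀ (z : Fin n) (σ : Fin n → Bool), s z σ ^ 2 = 1)
    (hM : ∀ σ, M σ = ∑ z, s z σ)
    (hV : ∀ P, V P = ∑ τ, w τ * (cE P (fun σ => M σ ^ 2) τ - cE P M τ ^ 2))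
    (P : Finset (Fin n)) (hc : 0 < ((Pᶜ.card : ℕ) : ℝ)) :
    ∑ z ∈ Pᶜ, V (insert z P) ≤ (Pᶜ.card : ℝ) * V P - V P ^ 2 / (Pᶜ.card : ℝ) := by
  have hVP : V P = ∑ z ∈ Pᶜ, ∑ τ, w τ * ((cE (insert z P) M τ - cE P M τ)
      * (s z τ - cE P (s z) τ)) := by
    simp only [cross hw hZ hcE hs]
    exact (sum_cov hw hZ hcE hs hM hV P).symm
  have hCS := weighted_cs Pᶜ univ w (fun z τ => cE (insert z P) M τ - cE P M τ)
    (fun z τ => s z τ - cE P (s z) τ) (fun τ _ => hw τ)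
  beta_reduce at hCS
  rw [← hVP] at hCS
  have hD : ∑ z ∈ Pᶜ, ∑ τ, w τ * (cE (insert z P) M τ - cE P M τ) ^ 2
      = (Pᶜ.card : ℝ) * V P - ∑ z ∈ Pᶜ, V (insert z P) := by
    rw [← sum_congr rfl (fun z _ => V_sub_V hw hZ hcE hV (subset_insert z P)), sum_sub_distrib,
      sum_const, nsmul_eq_mul]
  have hE : ∑ z ∈ Pᶜ, ∑ τ, w τ * (s z τ - cE P (s z) τ) ^ 2 ≤ (Pᶜ.card : ℝ) := by
    have h := sum_le_sum (fun z (_ : z ∈ Pᶜ) => e_sq_le hw hsum hZ hcE hs2 P z)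
    rwa [sum_const, nsmul_eq_mul, mul_one] at h
  rw [hD] at hCS
  have hnn : 0 ≤ (Pᶜ.card : ℝ) * V P - ∑ z ∈ Pᶜ, V (insert z P) := by
    rw [← hD]
    exact sum_nonneg (fun z _ => sum_nonneg (fun τ _ => mul_nonneg (hw τ) (sq_nonneg _)))
  have h2 : V P ^ 2 ≤ ((Pᶜ.card : ℝ) * V P - ∑ z ∈ Pᶜ, V (insert z P)) * (Pᶜ.card : ℝ) :=
    hCS.trans (mul_le_mul_of_nonneg_left hE hnn)
  have h3 : V P ^ 2 / (Pᶜ.card : ℝ) ≤ (Pᶜ.card : ℝ) * V P - ∑ z ∈ Pᶜ, V (insert z P) := by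
    rw [div_le_iff₀ hc]; exact h2
  linarith

end Summit.CriticalPhenomena.Ising3DConformalLimit.Theorems.PinningLemma

end
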